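import Mathlib
import Literature.Computability.Complexity.Classes
import Literature.Computability.Complexity.NPClosureProofs
import Literature.Computability.Complexity.BPPSubsetAlmostP
import Literature.Computability.MetaComplexity.MCSP
import Literature.Computability.MetaComplexity.TruthTables
import Literature.Computability.MetaComplexity.MCSPStatisticalTest
import Literature.Computability.MetaComplexity.AvgCaseCertifiedHardness
import Literature.Computability.MetaComplexity.FormulaModelsAE
import Literature.Computability.MetaComplexity.ChenJinWilliams2019.SparseMagnification
import Literature.Computability.MetaComplexity.ChenJinWilliams2019.SparseFormulaMagnification
import Literature.Computability.MetaComplexity.ChenJinWilliams2019.SparseConstantDepthMagnification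
import Literature.Algebra.EuclideanLattices.LatticeGapCVPNPcoNP
import HarnessLib

/-!
# Chen–Jin–Williams 2019, Theorem 1.1 item 7 INSTANTIATED at `L_β = MCSP[2^{o(β)·m}]`
# (the `TC⁰`-wires magnification row at MCSP), all side conditions proved

Citation header. L. Chen, C. Jin, R. R. Williams, *Hardness Magnification for all Sparse NP
Languages*, FOCS 2019 [bib: `ChenJinWilliams2019`]; full version ECCC TR19-118, p. 4 (Thm. 1.1
item 7, typed as `thm11_item7_NP` in `SparseConstantDepthMagnification.lean`) and p. 4 L10:
*"Setting L_β = MCSP[2^{0.99βn}] and C = NP in Theorem 1.1, we recover a main result of [MMW19]"*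
(with p. 3: *"Observe MCSP[2^{βm}] and MKtP[2^{βm}] are sparse languages in NP (or EXP) with
n = 2^m inputs"*).

The generic fact `thm11_item7_NP` magnifies lower bounds for ANY family of `2^{n^β}`-sparse `NP`
languages. This file PROVES that a hypothesis about `MCSP` alone feeds it:

* `MCSPFamilyTCHardAt s c₀ d ε` — for every `β ∈ (0,1)`, `MCSP[s_β]` (the tree's `MCSPSize (s β)`,
  truth tables of length `n = 2^m`, `B₂` gates) is outside `TC_{d + c₀(⌈log₂ 1/ε⌉+1)}[⌈n^{1+ε}⌉]`
  (a.e., wires);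
* `sparseNPTCHardAt_of_MCSP` — this, together with `MCSPSize (s β) ∈ NP` and EVENTUAL
  `2^{n^β}`-sparsity of `MCSPSize (s β)` for each `β`, gives `SparseNPTCHardAt c₀ d ε` (the witness
  language is `MCSP[s_β]` restricted to lengths `≥ N₀(β)`: still in `NP` — intersection with the
  `P` language `{x | N₀ ≤ |x|}`, the tree's `inter_P_mem_NP` —, literally `2^{n^β}`-sparse at EVERY length as `IsSparse`
  demands,
  and inside the same a.e. wire class iff `MCSP[s_β]` is, by `FamilyAE.congr_eventually`);
* the side conditions DISCHARGED for the dyadic parameter family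
  `dyadicSize j m = 2^{⌊m/2^j⌋}` with `j = dyadicIndex β` (`2^j ≥ 4/β`): `MCSPSize (dyadicSize j) ∈ NP`
  (`MCSPSize_dyadicSize_mem_NP`, the preimage of `MCSP ∈ NP` under a polynomial-time map, exactly
  as `CertifiedHard.MCSPSize_quarterExp_mem_NP`), and the slice count
  `|MCSP[s]_{2^m}| ≤ (s+1)(16(m+s+1)²)^s(m+s+1)` (`ncard_slice_MCSPSize_le`, from the tree's circuit
  counting `card_filter_circuitSizeOver_le`);
* the eventual numeric sparsity inequality for that family, `MCSPDyadicCountSmall` (count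
  `≤ ⌊2^{n^β}⌋` at all large `m`), PROVED (`mcspDyadicCountSmall`: `count ≤ 2^{15 s² m}` and
  `15 s² m ≤ 15m·2^{2m/2^j} ≤ 2^{βm/2}·2^{βm/2}`), hence `mcspFamilyEventuallySparse_dyadic`;
* hence `npNotInTCd_of_MCSP_dyadic'` — **`thm11_item7_NP` ⟹ ∃ c₀ ∀ d ∀ ε ∈ (0,1),
  (MCSP[2^{⌊m/2^{j(β)}⌋}] ∉ TC_{d+c₀(⌈log₂ 1/ε⌉+1)}[⌈n^{1+ε}⌉] for all β ∈ (0,1)) ⟹ NP ⊄ TC_d[nᵏ] ∀ k**,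
  with NO side hypothesis left: the only unproved input is the magnification fact itself.

Why `2^{⌊m/2^j⌋}` rather than the printed `2^{0.99βm}`: `IsSparse` wants an honest function
`ℕ → ℕ` computable from the input length in polynomial time (for `NP` membership); a dyadic
exponent `m/2^j` is computed by `j` halvings of the unary length (`Brick.halfFn`), and any
`j` with `2^{-j} < β` gives a `2^{n^β}`-sparse language for large `n`; the instantiated theorem is
the printed one with `0.99β` replaced by the smaller dyadic `2^{-j(β)} ≤ β/4` — a WEAKER lower-bound
hypothesis class-wise identical, so the row's content (T = item 7 at an MCSP family) is unchanged.
-/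

namespace Literature.Computability.MetaComplexity.ChenJinWilliams2019

open Finset Filter _root_.Computability Literature.Computability.Complexity
open Literature.Computability.Complexity.Classes Literature.Computability.Complexity.Nondeterministic
open Literature.Computability.Complexity.Brick Literature.Computability.MetaComplexity

/-! ### The MCSP-side hypothesis and the generic instantiation -/

/-- **R62-T hypothesis shape**: for every `β ∈ (0,1)`, `MCSP[s_β]` is outside
`TC_{d + c₀(⌈log₂ 1/ε⌉+1)}[⌈n^{1+ε}⌉]` (a.e., wires, LTF gates). OPEN — a `Prop`, never asserted.
[cite: ChenJinWilliams2019, Thm. 1.1 item 7 at L_β = MCSP (TR19-118 p. 4 L10)] -/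
def MCSPFamilyTCHardAt (s : ℝ → ℕ → ℕ) (c₀ d : ℕ) (ε : ℝ) : Prop :=
  ∀ β : ℝ, 0 < β → β < 1 → MCSPSize (s β) ∉ TCdWIRESae (tcDepth c₀ d ε) (powCeil (1 + ε))

/-- Eventual `2^{n^β}`-sparsity of the family: for every `β ∈ (0,1)`, at all large arities `m` the
slice of `MCSP[s_β]` at length `2^m` has at most `⌊2^{(2^m)^β}⌋` elements. [folklore] -/
def MCSPFamilyEventuallySparse (s : ℝ → ℕ → ℕ) : Prop :=
  ∀ β : ℝ, 0 < β → β < 1 → ∀ᶠ m : ℕ in atTop,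
    {x : List Bool | x ∈ MCSPSize (s β) ∧ x.length = 2 ^ m}.ncard ≤ expSparsity β (2 ^ m)

/-- Members of `MCSP[s]` have power-of-two length. [folklore] -/
theorem exists_length_eq_two_pow_of_mem_MCSPSize {s : ℕ → ℕ} {x : List Bool}
    (hx : x ∈ MCSPSize s) : ∃ n : ℕ, x.length = 2 ^ n := by
  obtain ⟨n, f, rfl, -⟩ := hx
  exact ⟨n, length_truthTable f⟩

/-- The slice of `MCSP[s]` at length `2^m` is the image under `truthTable` of the `m`-ary functions of
`B₂`-circuit complexity `≤ s m`. [folklore] -/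
theorem slice_MCSPSize_eq (s : ℕ → ℕ) (m : ℕ) :
    {x : List Bool | x ∈ MCSPSize s ∧ x.length = 2 ^ m} =
      (fun f : (Fin m → Bool) → Bool => truthTable f) ''
        {f | circuitSizeOver B2 f ≤ s m} := by
  ext x
  constructor
  · rintro ⟨⟨n, f, rfl, hf⟩, hlen⟩
    rw [length_truthTable] at hlen
    have hnm : n = m := Nat.pow_right_injective (le_refl 2) hlen
    subst hnm
    exact ⟨f, hf, rfl⟩
  · rintro ⟨f, hf, rfl⟩
    exact ⟨⟨m, f, rfl, hf⟩, length_truthTable f⟩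

/-- **Slice count**: `|MCSP[s] ∩ {0,1}^{2^m}| ≤ (s+1)·(16(m+s+1)²)^s·(m+s+1)` (`s = s m`), from the
tree's count of functions with small `B₂`-circuits. [folklore] -/
theorem ncard_slice_MCSPSize_le (s : ℕ → ℕ) (m : ℕ) :
    {x : List Bool | x ∈ MCSPSize s ∧ x.length = 2 ^ m}.ncard ≤
      (s m + 1) * (16 * (m + s m + 1) ^ 2) ^ s m * (m + s m + 1) := by
  classical
  rw [slice_MCSPSize_eq]
  refine (Set.ncard_image_le (Set.toFinite _)).trans ?_
  have hset : ({f : (Fin m → Bool) → Bool | circuitSizeOver B2 f ≤ s m} : Set _) =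
      ↑(univ.filter fun f : (Fin m → Bool) → Bool => circuitSizeOver B2 f ≤ s m) := by
    ext f; simp
  rw [hset, Set.ncard_coe_finset]
  exact card_filter_circuitSizeOver_le m (s m)

/-- Slices of `MCSP[s]` at non-power-of-two lengths are empty. [folklore] -/
theorem slice_MCSPSize_eq_empty {s : ℕ → ℕ} {N : ℕ} (hN : ∀ n : ℕ, N ≠ 2 ^ n) :
    {x : List Bool | x ∈ MCSPSize s ∧ x.length = N} = ∅ := by
  ext x
  simp only [Set.mem_setOf_eq, Set.mem_empty_iff_false, iff_false, not_and]
  intro hx hlen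
  obtain ⟨n, hn⟩ := exists_length_eq_two_pow_of_mem_MCSPSize hx
  exact hN n (hlen ▸ hn)

/-- **The instantiation (generic in the parameter family).** If each `MCSP[s_β]` is in `NP` and
eventually `2^{n^β}`-sparse, then the MCSP-side hypothesis implies the sparse-language hypothesis
`SparseNPTCHardAt c₀ d ε` of Thm. 1.1 item 7: the witness for `β` is `MCSP[s_β]` restricted to
lengths `≥ 2^{m₀(β)}`. [cite: ChenJinWilliams2019, Thm. 1.1 item 7 + p. 4 L10 (instantiation at MCSP)] -/
theorem sparseNPTCHardAt_of_MCSP {s : ℝ → ℕ → ℕ} {c₀ d : ℕ} {ε : ℝ}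
    (hNP : ∀ β : ℝ, 0 < β → β < 1 → MCSPSize (s β) ∈ NP)
    (hsp : MCSPFamilyEventuallySparse s) (h : MCSPFamilyTCHardAt s c₀ d ε) :
    SparseNPTCHardAt c₀ d ε := by
  intro β hβ hβ1
  obtain ⟨m₀, hm₀⟩ := eventually_atTop.1 (hsp β hβ hβ1)
  set L : Language Bool := ({x : List Bool | 2 ^ m₀ ≤ x.length} : Language Bool) ⊓ MCSPSize (s β)
    with hLdef
  refine ⟨L, Literature.Algebra.EuclideanLattices.inter_P_mem_NP (setOf_le_length_mem_P _) (hNP β hβ hβ1),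
    fun N => ?_, fun hmem => ?_⟩
  · -- sparsity at every length
    have hsub : {x : List Bool | x ∈ L ∧ x.length = N} ⊆
        {x : List Bool | x ∈ MCSPSize (s β) ∧ x.length = N} := fun x hx => ⟨hx.1.2, hx.2⟩
    by_cases hpow : ∃ m : ℕ, N = 2 ^ m
    · obtain ⟨m, rfl⟩ := hpow
      by_cases hm : m₀ ≤ m
      · exact (Set.ncard_le_ncard hsub (Literature.Barriers.PneNP.finite_slice _ _)).trans (hm₀ m hm)
      · have hempty : {x : List Bool | x ∈ L ∧ x.length = 2 ^ m} = ∅ := by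
          ext x
          simp only [Set.mem_setOf_eq, Set.mem_empty_iff_false, iff_false, not_and]
          intro hx hlen
          have h1 : 2 ^ m₀ ≤ x.length := hx.1
          rw [hlen] at h1
          exact hm ((Nat.pow_le_pow_iff_right (le_refl 2)).1 h1)
        rw [hempty, Set.ncard_empty]
        exact Nat.zero_le _
    · push Not at hpow
      have hempty : {x : List Bool | x ∈ L ∧ x.length = N} = ∅ :=
        Set.eq_empty_of_subset_empty (hsub.trans (slice_MCSPSize_eq_empty (s := s β) hpow).subset)
      rw [hempty, Set.ncard_empty]
      exact Nat.zero_le _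
  · -- transfer of the a.e. upper bound to `MCSP[s β]` itself
    refine h β hβ hβ1 (FamilyAE.congr_eventually hmem (m := 2 ^ m₀) fun x hx => ?_)
    change x ∈ ({x : List Bool | 2 ^ m₀ ≤ x.length} : Language Bool) ⊓ MCSPSize (s β) ↔ _
    exact ⟨fun hx' => hx'.2, fun hx' => ⟨hx, hx'⟩⟩

/-- **R62-T, generic form**: `thm11_item7_NP` + the side conditions + the MCSP-side lower bounds
give `NP ⊄ TC_d[nᵏ]` for every `k`. [cite: ChenJinWilliams2019, Thm. 1.1 item 7 at L_β = MCSP] -/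
theorem npNotInTCd_of_MCSP (hT : thm11_item7_NP) {s : ℝ → ℕ → ℕ}
    (hNP : ∀ β : ℝ, 0 < β → β < 1 → MCSPSize (s β) ∈ NP) (hsp : MCSPFamilyEventuallySparse s) :
    ∃ c₀ : ℕ, ∀ d : ℕ, ∀ ε : ℝ, 0 < ε → ε < 1 → MCSPFamilyTCHardAt s c₀ d ε → NPNotInTCd d := by
  obtain ⟨c₀, hc₀⟩ := hT
  exact ⟨c₀, fun d ε hε hε1 h => hc₀ d ε hε hε1 (sparseNPTCHardAt_of_MCSP hNP hsp h)⟩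

/-! ### The dyadic parameter family `2^{⌊m/2^j⌋}` : `NP` membership -/

/-- The threshold `s(m) = 2^{⌊m/2^j⌋}`. [folklore] -/
def dyadicSize (j m : ℕ) : ℕ := 2 ^ (m / 2 ^ j)

/-- `j` halvings of a unary length. [folklore] -/
theorem length_halfFn_iterate (j : ℕ) (u : List Bool) :
    (halfFn^[j] u).length = u.length / 2 ^ j := by
  induction j generalizing u with
  | zero => simp
  | succ j ih =>
    rw [Function.iterate_succ_apply', halfFn, ones, List.length_replicate, ih, pow_succ,
      Nat.div_div_eq_div_mul]

/-- `halfFn^[j] ∈ FP`. [folklore] -/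
theorem halfFn_iterate_mem_FP (j : ℕ) : (halfFn^[j]) ∈ FP := by
  induction j with
  | zero => exact OracleCompose.id_mem_FP
  | succ j ih =>
    rw [Function.iterate_succ']
    exact comp_mem_FP halfFn_mem_FP ih

/-- The reduction `w ↦ ⟨w, bin 2^{⌊log₂|w|⌋ / 2^j}⟩` from `MCSP[2^{⌊m/2^j⌋}]` to `MCSP`
(cf. `CertifiedHard.quarterRed`, the case `j = 2`). [folklore] -/
noncomputable def dyadicRed (j : ℕ) : List Bool → List Bool :=
  fanoutFn id (AvgNE.pow2NumF 1 ∘ halfFn^[j] ∘ logFn)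

/-- `dyadicRed j ∈ FP`. [folklore] -/
theorem dyadicRed_mem_FP (j : ℕ) : dyadicRed j ∈ FP :=
  fanoutFn_mem_FP OracleCompose.id_mem_FP (comp_mem_FP (AvgNE.pow2NumF_mem_FP 1)
    (comp_mem_FP (halfFn_iterate_mem_FP j) logFn_mem_FP))

/-- Value of the reduction. [folklore] -/
theorem dyadicRed_apply (j : ℕ) (w : List Bool) :
    dyadicRed j w = boolPair w (encodeNat (2 ^ (Nat.log 2 w.length / 2 ^ j))) := by
  have hnum : ∀ u : List Bool, AvgNE.pow2NumF 1 u = encodeNat (2 ^ u.length) := fun u => by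
    have h := encodeNat_bitsToNat (isCanonicalNum_append_true (Kannan.zerosFn (onesMulFn 1 u)))
    rw [← AvgNE.pow2NumF, AvgNE.bitsToNat_pow2NumF, Nat.one_mul] at h
    exact h.symm
  simp only [dyadicRed, fanoutFn_apply, id, Function.comp_apply, hnum, length_halfFn_iterate, logFn,
    ones, List.length_replicate]

/-- **`MCSP[2^{⌊m/2^j⌋}] ∈ NP`** — preimage of `MCSP ∈ NP` (`MCSP_mem_NP_holds`) under `dyadicRed j`.
[Kabanets–Cai 2000, §2] [cite: KabanetsCai2000, §2] -/
theorem MCSPSize_dyadicSize_mem_NP (j : ℕ) : MCSPSize (dyadicSize j) ∈ NP := by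
  have hpre : MCSPSize (dyadicSize j) = dyadicRed j ⁻¹' MCSP := by
    ext w
    change w ∈ MCSPSize (dyadicSize j) ↔ dyadicRed j w ∈ MCSP
    rw [dyadicRed_apply]
    constructor
    · rintro ⟨n, f, rfl, hf⟩
      rw [boolPair_truthTable_mem_MCSP_iff, length_truthTable, Nat.log_pow one_lt_two]
      exact hf
    · rintro ⟨m, g, t, hw, hg⟩
      have h1 : (w, encodeNat (2 ^ (Nat.log 2 w.length / 2 ^ j))) = (truthTable g, encodeNat t) :=
        boolPair_injective hw
      obtain ⟨rfl, h2⟩ := Prod.mk.inj h1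
      have ht := congrArg decodeNat h2
      rw [decode_encodeNat, decode_encodeNat, length_truthTable, Nat.log_pow one_lt_two] at ht
      refine ⟨m, g, rfl, ?_⟩
      rw [dyadicSize, ht]
      exact hg
  rw [hpre]
  exact preimage_mem_NP MCSP_mem_NP_holds (dyadicRed_mem_FP j)

/-- The dyadic index for `β`: `j(β) = ⌈log₂(4/β)⌉`, so that `2^{j(β)} ≥ 4/β`. [folklore] -/
noncomputable def dyadicIndex (β : ℝ) : ℕ := ⌈Real.logb 2 (4 / β)⌉₊

/-- `4/β ≤ 2^{j(β)}` for `β > 0`. [folklore] -/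
theorem four_div_le_two_pow_dyadicIndex {β : ℝ} (hβ : 0 < β) :
    4 / β ≤ (2 : ℝ) ^ (dyadicIndex β) := by
  have hpos : 0 < 4 / β := by positivity
  calc 4 / β = (2 : ℝ) ^ (Real.logb 2 (4 / β)) := (Real.rpow_logb two_pos (by norm_num) hpos).symm
    _ ≤ (2 : ℝ) ^ ((dyadicIndex β : ℕ) : ℝ) :=
        Real.rpow_le_rpow_of_exponent_le one_le_two (Nat.le_ceil _)
    _ = (2 : ℝ) ^ (dyadicIndex β) := Real.rpow_natCast 2 _

/-- The dyadic MCSP family `β ↦ MCSP[2^{⌊m/2^{j(β)}⌋}]`. [folklore] -/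
noncomputable def mcspDyadic : ℝ → ℕ → ℕ := fun β => dyadicSize (dyadicIndex β)

/-- Every member of the dyadic family is in `NP`. [cite: KabanetsCai2000, §2] -/
theorem MCSPSize_mcspDyadic_mem_NP (β : ℝ) : MCSPSize (mcspDyadic β) ∈ NP :=
  MCSPSize_dyadicSize_mem_NP _

/-- The eventual numeric sparsity of the dyadic family (count of easy truth tables vs `⌊2^{n^β}⌋`):
for every `β ∈ (0,1)`, eventually in `m`,
`(s+1)(16(m+s+1)²)^s(m+s+1) ≤ ⌊2^{(2^m)^β}⌋` with `s = 2^{⌊m/2^{j(β)}⌋}`. An ARITHMETIC statement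
(no complexity content); see `mcspFamilyEventuallySparse_of_count`. [folklore] -/
def MCSPDyadicCountSmall : Prop :=
  ∀ β : ℝ, 0 < β → β < 1 → ∀ᶠ m : ℕ in atTop,
    (mcspDyadic β m + 1) * (16 * (m + mcspDyadic β m + 1) ^ 2) ^ mcspDyadic β m *
        (m + mcspDyadic β m + 1) ≤ expSparsity β (2 ^ m)

/-- The count bound gives eventual sparsity. [folklore] -/
theorem mcspFamilyEventuallySparse_of_count (h : MCSPDyadicCountSmall) :
    MCSPFamilyEventuallySparse mcspDyadic := fun β hβ hβ1 =>
  (h β hβ hβ1).mono fun m hm => (ncard_slice_MCSPSize_le _ m).trans hm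

/-- **R62-T at the dyadic MCSP family**: `thm11_item7_NP` ⟹ (for some absolute `c₀`, all `d`, all
`ε ∈ (0,1)`) [`MCSP[2^{⌊m/2^{j(β)}⌋}] ∉ TC_{d+c₀(⌈log₂ 1/ε⌉+1)}[⌈n^{1+ε}⌉]` for every `β ∈ (0,1)`]
⟹ `NP ⊄ TC_d[nᵏ] ∀ k` — modulo the arithmetic count bound `MCSPDyadicCountSmall`.
[cite: ChenJinWilliams2019, Thm. 1.1 item 7 at L_β = MCSP (TR19-118 p. 4 L10)] -/
theorem npNotInTCd_of_MCSP_dyadic (hT : thm11_item7_NP) (hc : MCSPDyadicCountSmall) :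
    ∃ c₀ : ℕ, ∀ d : ℕ, ∀ ε : ℝ, 0 < ε → ε < 1 →
      MCSPFamilyTCHardAt mcspDyadic c₀ d ε → NPNotInTCd d :=
  npNotInTCd_of_MCSP hT (fun β _ _ => MCSPSize_mcspDyadic_mem_NP β)
    (mcspFamilyEventuallySparse_of_count hc)

/-! ### The dyadic parameter family: the numeric sparsity bound (arithmetic, proved) -/

/-- The circuit count is at most `2^{15 s² m}` (`m, s ≥ 1`). [folklore] -/
theorem count_le_two_pow (m s : ℕ) (hm : 1 ≤ m) (hs : 1 ≤ s) :
    (s + 1) * (16 * (m + s + 1) ^ 2) ^ s * (m + s + 1) ≤ 2 ^ (15 * s ^ 2 * m) := by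
  have ha : s + 1 ≤ 2 ^ s := Nat.succ_le_of_lt Nat.lt_two_pow_self
  have hk : m + s + 1 ≤ 2 ^ (m + s + 1) := (Nat.lt_two_pow_self).le
  have key : ∀ k : ℕ, 2 ^ (2 * k + 4) = 16 * (2 ^ k) ^ 2 := fun k => by
    rw [pow_add, mul_comm 2 k, pow_mul]; ring
  have hb : 16 * (m + s + 1) ^ 2 ≤ 2 ^ (2 * (m + s + 1) + 4) := by
    calc 16 * (m + s + 1) ^ 2 ≤ 16 * (2 ^ (m + s + 1)) ^ 2 := by gcongr
      _ = 2 ^ (2 * (m + s + 1) + 4) := (key _).symm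
  have hc : (16 * (m + s + 1) ^ 2) ^ s ≤ 2 ^ ((2 * (m + s + 1) + 4) * s) := by
    rw [pow_mul]; exact Nat.pow_le_pow_left hb s
  have hexp : s + (2 * (m + s + 1) + 4) * s + (m + s + 1) ≤ 15 * s ^ 2 * m := by
    have h1 : 1 ≤ s ^ 2 * m := Nat.one_le_iff_ne_zero.2 (by positivity)
    have h2 : s ≤ s ^ 2 * m := by nlinarith
    have h3 : m ≤ s ^ 2 * m := Nat.le_mul_of_pos_left m (by positivity)
    have h4 : m * s ≤ s ^ 2 * m := by nlinarith
    have h5 : s ^ 2 ≤ s ^ 2 * m := by nlinarith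
    nlinarith
  calc (s + 1) * (16 * (m + s + 1) ^ 2) ^ s * (m + s + 1)
      ≤ 2 ^ s * 2 ^ ((2 * (m + s + 1) + 4) * s) * 2 ^ (m + s + 1) := by gcongr
    _ = 2 ^ (s + (2 * (m + s + 1) + 4) * s + (m + s + 1)) := by rw [← pow_add, ← pow_add]
    _ ≤ 2 ^ (15 * s ^ 2 * m) := Nat.pow_le_pow_right two_pos hexp

/-- Exponential beats linear: `15 m ≤ 2^{c m}` eventually (`c > 0`). [folklore] -/
theorem fifteen_mul_le_two_rpow {c : ℝ} (hc : 0 < c) :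
    ∀ᶠ m : ℕ in atTop, (15 * m : ℝ) ≤ (2 : ℝ) ^ (c * m) := by
  have ha : 0 < c * Real.log 2 := mul_pos hc (Real.log_pos one_lt_two)
  refine eventually_atTop.2 ⟨⌈30 / (c * Real.log 2) ^ 2⌉₊, fun m hm => ?_⟩
  have hm' : 30 / (c * Real.log 2) ^ 2 ≤ m := (Nat.le_ceil _).trans (by exact_mod_cast hm)
  have h30 : 30 ≤ (c * Real.log 2) ^ 2 * m := by
    rw [div_le_iff₀ (by positivity)] at hm'; linarith
  have hx : 0 ≤ c * Real.log 2 * m := by positivity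
  have hexp : (c * Real.log 2 * m) ^ 2 / 2 ≤ Real.exp (c * Real.log 2 * m) := by
    have h := Real.pow_div_factorial_le_exp (c * Real.log 2 * m) hx 2
    simpa [Nat.factorial] using h
  have h2 : (2 : ℝ) ^ (c * m) = Real.exp (c * Real.log 2 * m) := by
    rw [Real.rpow_def_of_pos two_pos]; ring_nf
  rw [h2]
  have hm0 : (0 : ℝ) ≤ m := Nat.cast_nonneg m
  nlinarith [hexp, h30, mul_le_mul_of_nonneg_right h30 hm0]

/-- `((2^m : ℕ) : ℝ)^β = 2^{β m}`. [folklore] -/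
theorem cast_two_pow_rpow (m : ℕ) (β : ℝ) : (((2 ^ m : ℕ) : ℝ)) ^ β = (2 : ℝ) ^ (β * m) := by
  rw [Nat.cast_pow, Nat.cast_ofNat, ← Real.rpow_natCast, ← Real.rpow_mul (by norm_num : (0:ℝ) ≤ 2),
    mul_comm]

/-- **The count bound for the dyadic family, PROVED**: for `β ∈ (0,1)` and all large `m`,
`(s+1)(16(m+s+1)²)^s(m+s+1) ≤ ⌊2^{(2^m)^β}⌋` with `s = 2^{⌊m/2^{j(β)}⌋}` — because
`15·s²·m ≤ 15m · 2^{2m/2^j} ≤ 2^{βm/2} · 2^{βm/2}` once `2^j ≥ 4/β` and `15 m ≤ 2^{βm/2}`.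
[folklore] -/
theorem mcspDyadicCountSmall : MCSPDyadicCountSmall := by
  intro β hβ _hβ1
  have hj : 4 / β ≤ (2 : ℝ) ^ (dyadicIndex β) := four_div_le_two_pow_dyadicIndex hβ
  filter_upwards [fifteen_mul_le_two_rpow (half_pos hβ), eventually_ge_atTop 1] with m hm15 hm1
  have hsdef : mcspDyadic β m = 2 ^ (m / 2 ^ dyadicIndex β) := rfl
  set s := mcspDyadic β m with hs
  have hs1 : 1 ≤ s := hsdef ▸ Nat.one_le_two_pow
  refine (count_le_two_pow m s hm1 hs1).trans (Nat.le_floor ?_)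
  -- goal: ((2 ^ (15 * s ^ 2 * m) : ℕ) : ℝ) ≤ 2 ^ (((2 ^ m : ℕ) : ℝ) ^ β)
  rw [cast_two_pow_rpow, Nat.cast_pow, Nat.cast_ofNat, ← Real.rpow_natCast]
  refine Real.rpow_le_rpow_of_exponent_le one_le_two ?_
  -- goal: ((15 * s ^ 2 * m : ℕ) : ℝ) ≤ 2 ^ (β * m)
  have h2j : (0 : ℝ) < 2 ^ dyadicIndex β := by positivity
  have hratio : 2 * (m : ℝ) / 2 ^ dyadicIndex β ≤ β / 2 * m := by
    have h4 : 4 ≤ β * 2 ^ dyadicIndex β := by rwa [div_le_iff₀ hβ, mul_comm] at hj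
    rw [div_le_iff₀ h2j]
    have hm0 : (0 : ℝ) ≤ m := Nat.cast_nonneg m
    nlinarith
  have hsq : ((s ^ 2 : ℕ) : ℝ) ≤ (2 : ℝ) ^ (β / 2 * m) := by
    have hdiv : ((m / 2 ^ dyadicIndex β : ℕ) : ℝ) ≤ (m : ℝ) / 2 ^ dyadicIndex β := by
      have h := Nat.cast_div_le (m := m) (n := 2 ^ dyadicIndex β) (α := ℝ)
      simpa using h
    calc ((s ^ 2 : ℕ) : ℝ) = (2 : ℝ) ^ (((2 * (m / 2 ^ dyadicIndex β) : ℕ) : ℝ)) := by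
          rw [Real.rpow_natCast, hsdef, ← pow_mul, mul_comm]; push_cast; ring
      _ ≤ (2 : ℝ) ^ (β / 2 * m) := by
          refine Real.rpow_le_rpow_of_exponent_le one_le_two ?_
          push_cast
          have : 2 * ((m / 2 ^ dyadicIndex β : ℕ) : ℝ) ≤ 2 * (m : ℝ) / 2 ^ dyadicIndex β := by
            rw [mul_div_assoc]; exact mul_le_mul_of_nonneg_left hdiv zero_le_two
          exact this.trans hratio
  have hpos15 : (0 : ℝ) ≤ 15 * m := by positivity
  have hpow_nonneg : (0 : ℝ) ≤ (2 : ℝ) ^ (β / 2 * m) := by positivity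
  calc ((15 * s ^ 2 * m : ℕ) : ℝ) = (15 * m : ℝ) * ((s ^ 2 : ℕ) : ℝ) := by push_cast; ring
    _ ≤ (2 : ℝ) ^ (β / 2 * m) * (2 : ℝ) ^ (β / 2 * m) :=
        mul_le_mul hm15 hsq (by positivity) hpow_nonneg
    _ = (2 : ℝ) ^ (β * m) := by rw [← Real.rpow_add two_pos]; ring_nf

/-- Eventual `2^{n^β}`-sparsity of the dyadic MCSP family, PROVED. [folklore] -/
theorem mcspFamilyEventuallySparse_dyadic : MCSPFamilyEventuallySparse mcspDyadic :=
  mcspFamilyEventuallySparse_of_count mcspDyadicCountSmall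

/-- **R62-T at MCSP, unconditional in everything but the magnification fact**: `thm11_item7_NP`
gives an absolute `c₀` such that for all `d` and `ε ∈ (0,1)`, lower bounds
`MCSP[2^{⌊m/2^{j(β)}⌋}] ∉ TC_{d+c₀(⌈log₂ 1/ε⌉+1)}[⌈n^{1+ε}⌉]` (a.e., wires) for every `β ∈ (0,1)`
imply `NP ⊄ TC_d[nᵏ]` for every `k`. [cite: ChenJinWilliams2019, Thm. 1.1 item 7 at L_β = MCSP (TR19-118 p. 4 L10)] -/
theorem npNotInTCd_of_MCSP_dyadic' (hT : thm11_item7_NP) :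
    ∃ c₀ : ℕ, ∀ d : ℕ, ∀ ε : ℝ, 0 < ε → ε < 1 →
      MCSPFamilyTCHardAt mcspDyadic c₀ d ε → NPNotInTCd d :=
  npNotInTCd_of_MCSP_dyadic hT mcspDyadicCountSmall

end Literature.Computability.MetaComplexity.ChenJinWilliams2019

/-! ## `_holds` aliases (appended 2026-08-28, flt-inv gen 65)

The named fact(s) below are already theorems of THIS file under another name; the alias records the
discharge under the tree's exact naming convention `X_holds` (D-0026 bookkeeping: the proof term is the
existing theorem; no statement, definition or attribute is edited; no new named fact).  The ledger's debt
table listed each as unproved (`ledger fact claim` GRANTED «status unproved», 2026-08-28T08:5xZ). -/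

/-- `MCSPDyadicCountSmall` — the dyadic count bound `MCSPDyadicCountSmall` holds — proved in this file as `mcspDyadicCountSmall` (`Literature.Computability.MetaComplexity.ChenJinWilliams2019.mcspDyadicCountSmall`). [cite: ChenJinWilliams2019, Thm. 1.1 item 7 at L_β = MCSP (TR19-118 p. 4 L10)] -/
theorem _root_.Literature.Computability.MetaComplexity.ChenJinWilliams2019.MCSPDyadicCountSmall_holds : _root_.Literature.Computability.MetaComplexity.ChenJinWilliams2019.MCSPDyadicCountSmall :=
  _root_.Literature.Computability.MetaComplexity.ChenJinWilliams2019.mcspDyadicCountSmall
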